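import Literature.RingTheory.Flat.NilpotentCriterionRelative
import Mathlib.AlgebraicGeometry.Morphisms.Flat
import Mathlib.AlgebraicGeometry.Morphisms.Affine
import Mathlib.RingTheory.HopkinsLevitzki
import Mathlib.RingTheory.DualNumber
import Mathlib.Algebra.TrivSqZeroExt.Ideal
import HarnessLib

/-!
# Flatness of a morphism is detected modulo a nilpotent thickening of the base

Topic `Literature/AlgebraicGeometry/Morphisms`; theorems only (no definition, no named fact, no
instance). The scheme-theoretic form of Matsumura's nilpotent flatness criterion
([Matsumura1987] §22 Thm. 22.3 (α) (3) ⇒ (1); ring form in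
`Literature/RingTheory/Flat/NilpotentCriterionRelative.lean`): let `g : S₀ ⟶ S` be a morphism
of AFFINE schemes whose map on global sections is surjective with finitely generated nilpotent
kernel (an infinitesimal thickening: `Spec (R/J) ⟶ Spec R` for `J` nilpotent and finitely
generated, the closed point `Spec k ⟶ Spec R` of an Artinian local ring, `Spec k ⟶ Spec k[ε]`),
and let
```
P₀ --iP--> P
|f₀        |f
v          v
Q₀ --iQ--> Q
|q₀        |q
v          v
S₀ --g---> S
```
be two cartesian squares. If `P` is flat over `S` (i.e. `f ≫ q` is flat) and the base change
`f₀` is flat, then `f` is flat.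

Proof: flatness is affine-local on source and target (Mathlib `HasRingHomProperty @Flat`); for
affine opens `U ⊆ Q`, `V ⊆ f⁻¹U` the opens `iQ⁻¹U`, `iP⁻¹V` are affine (the immersions are
affine morphisms, being base changes of `g`) and the section rings form two pushout squares
(Mathlib `isIso_pushoutSection_of_isAffineOpen`), so the ring form
`Literature.RingTheory.Flat.flat_of_isPushout_of_isNilpotent_ker` applies chart by chart.

* `flat_of_flat_of_isPullback_of_surjective_appTop` — the statement above;
* `flat_of_flat_of_isPullback_specMap` — base `Spec.map ρ : Spec R₀ ⟶ Spec R`, `ρ` surjective with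
  finitely generated nilpotent kernel;
* `flat_of_flat_of_isPullback_specMap_quotient_mk` — `Spec (R ⧸ J) ⟶ Spec R`;
* `flat_of_flat_of_isPullback_specMap_residue` — `Spec (ResidueField R) ⟶ Spec R`, `R` an
  Artinian local ring (flatness over an Artinian local base is detected on the closed fibre);
* `flat_of_flat_of_isPullback_specMap_dualNumber_fst` — `Spec k ⟶ Spec k[ε]`.

## References
* [Matsumura1987] H. Matsumura, *Commutative Ring Theory*, CSAM 8, §22 Thm. 22.3 (α) (3) ⇒ (1)
  (book p. 174).
* [GortzWedhorn2020] U. Görtz, T. Wedhorn, *Algebraic Geometry I*, 2nd ed., Def. 14.8 and §(14.7)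
  (flat morphisms; flatness is local and stable under base change), for the language.
-/

noncomputable section

open CategoryTheory CategoryTheory.Limits AlgebraicGeometry

universe u

namespace Literature.AlgebraicGeometry.Morphisms

/-! ## §1 Affine thickenings of the base -/

section Affine

variable {S S₀ P Q P₀ Q₀ : Scheme.{u}} [IsAffine S] [IsAffine S₀] {g : S₀ ⟶ S}
  {f : P ⟶ Q} {q : Q ⟶ S} {iQ : Q₀ ⟶ Q} {q₀ : Q₀ ⟶ S₀} {f₀ : P₀ ⟶ Q₀} {iP : P₀ ⟶ P}

omit [IsAffine S] [IsAffine S₀] in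
/-- For a morphism `g` with `g ⁻¹ᵁ ⊤ = ⊤`, `g.appLE ⊤ ⊤ _` is `g.appTop`. [folklore] -/
private theorem appLE_top_top (g : S₀ ⟶ S) : g.appLE ⊤ ⊤ le_top = g.appTop := by
  rw [Scheme.Hom.appTop, Scheme.Hom.app_eq_appLE]
  rfl

/-- **Flatness modulo a nilpotent thickening of an affine base** (Matsumura Thm. 22.3 (α),
(3) ⇒ (1), chart by chart). Let `g : S₀ ⟶ S` be a morphism of affine schemes such that
`Γ(g) : Γ(S) → Γ(S₀)` is surjective with finitely generated nilpotent kernel, `q : Q ⟶ S`,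
`f : P ⟶ Q`, and let `Q₀ = Q ×_S S₀`, `P₀ = P ×_Q Q₀` be given by cartesian squares
`hQ : IsPullback iQ q₀ q g`, `hP : IsPullback iP f₀ f iQ`. If `f ≫ q` is flat (`P` flat over `S`)
and `f₀` is flat, then `f` is flat. [cite: Matsumura1987, §22 Thm. 22.3 (α), (3) ⇒ (1)] -/
theorem flat_of_flat_of_isPullback_of_surjective_appTop
    (hg : Function.Surjective g.appTop.hom) (hnil : IsNilpotent (RingHom.ker g.appTop.hom))
    (hfg : (RingHom.ker g.appTop.hom).FG) (hQ : IsPullback iQ q₀ q g)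
    (hP : IsPullback iP f₀ f iQ) [Flat (f ≫ q)] [Flat f₀] : Flat f := by
  -- the immersions `iQ`, `iP` are affine morphisms (base changes of the affine morphism `g`)
  haveI : IsAffineHom iQ := MorphismProperty.of_isPullback hQ.flip inferInstance
  haveI : IsAffineHom iP := MorphismProperty.of_isPullback hP.flip inferInstance
  rw [HasRingHomProperty.iff_appLE (P := @Flat)]
  intro U V e
  -- affine charts downstairs
  have hU₀ : IsAffineOpen (iQ ⁻¹ᵁ (U : Q.Opens)) := U.2.preimage iQ
  have hV₀ : IsAffineOpen (iP ⁻¹ᵁ (V : P.Opens)) := V.2.preimage iP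
  have e₀ : iP ⁻¹ᵁ (V : P.Opens) ≤ f₀ ⁻¹ᵁ (iQ ⁻¹ᵁ (U : Q.Opens)) := by
    rw [← Scheme.Hom.comp_preimage, ← hP.w, Scheme.Hom.comp_preimage]
    exact Scheme.Hom.preimage_mono iP e
  -- the base square on sections: `Γ(Q₀, iQ⁻¹U)` is a pushout of `Γ(Q,U) ← Γ(S) → Γ(S₀)`
  have hUY₁ : iQ ⁻¹ᵁ (U : Q.Opens) = iQ ⁻¹ᵁ (U : Q.Opens) ⊓ q₀ ⁻¹ᵁ ⊤ := by
    simp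
  have T₁ : IsPushout (q.appLE ⊤ U le_top) (g.appLE ⊤ ⊤ le_top)
      (iQ.appLE U (iQ ⁻¹ᵁ (U : Q.Opens)) le_rfl) (q₀.appLE ⊤ (iQ ⁻¹ᵁ (U : Q.Opens)) le_top) := by
    have hiso := isIso_pushoutSection_of_isAffineOpen hQ (le_top : (⊤ : S₀.Opens) ≤ g ⁻¹ᵁ ⊤)
      (le_top : (U : Q.Opens) ≤ q ⁻¹ᵁ ⊤) hUY₁ (isAffineOpen_top S) (isAffineOpen_top S₀) U.2
    exact (isIso_pushoutSection_iff hQ _ _ hUY₁).mp hiso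
  -- the upper square on sections: `Γ(P₀, iP⁻¹V)` is a pushout of `Γ(P,V) ← Γ(Q,U) → Γ(Q₀, iQ⁻¹U)`
  have hUY₂ : iP ⁻¹ᵁ (V : P.Opens) = iP ⁻¹ᵁ (V : P.Opens) ⊓ f₀ ⁻¹ᵁ (iQ ⁻¹ᵁ (U : Q.Opens)) :=
    (inf_eq_left.mpr e₀).symm
  have T₂ : IsPushout (f.appLE U V e) (iQ.appLE U (iQ ⁻¹ᵁ (U : Q.Opens)) le_rfl)
      (iP.appLE V (iP ⁻¹ᵁ (V : P.Opens)) le_rfl)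
      (f₀.appLE (iQ ⁻¹ᵁ (U : Q.Opens)) (iP ⁻¹ᵁ (V : P.Opens)) e₀) := by
    have hiso := isIso_pushoutSection_of_isAffineOpen hP
      (le_rfl : iQ ⁻¹ᵁ (U : Q.Opens) ≤ iQ ⁻¹ᵁ (U : Q.Opens)) e hUY₂ U.2 hU₀ V.2
    exact (isIso_pushoutSection_iff hP _ _ hUY₂).mp hiso
  -- flatness hypotheses on the charts
  have hRB : (q.appLE ⊤ U le_top ≫ f.appLE U V e).hom.Flat := by
    rw [Scheme.Hom.appLE_comp_appLE]
    exact HasRingHomProperty.appLE @Flat (f ≫ q) ‹_› ⟨⊤, isAffineOpen_top S⟩ V _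
  have hφ₀ : (f₀.appLE (iQ ⁻¹ᵁ (U : Q.Opens)) (iP ⁻¹ᵁ (V : P.Opens)) e₀).hom.Flat :=
    HasRingHomProperty.appLE @Flat f₀ ‹_› ⟨_, hU₀⟩ ⟨_, hV₀⟩ e₀
  -- the base map `Γ(g)`
  have hg' : Function.Surjective (g.appLE ⊤ ⊤ le_top).hom := by rwa [appLE_top_top]
  have hnil' : IsNilpotent (RingHom.ker (g.appLE ⊤ ⊤ le_top).hom) := by rwa [appLE_top_top]
  have hfg' : (RingHom.ker (g.appLE ⊤ ⊤ le_top).hom).FG := by rwa [appLE_top_top]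
  exact Literature.RingTheory.Flat.flat_of_isPushout_of_isNilpotent_ker hg' hnil' hfg' T₁ T₂
    hRB hφ₀

end Affine

/-! ## §2 `Spec` bases -/

section SpecBase

variable {R R₀ : CommRingCat.{u}} {P Q P₀ Q₀ : Scheme.{u}} {f : P ⟶ Q} {q : Q ⟶ Spec R}
  {iQ : Q₀ ⟶ Q} {q₀ : Q₀ ⟶ Spec R₀} {f₀ : P₀ ⟶ Q₀} {iP : P₀ ⟶ P}

/-- `Γ(Spec ρ)` is `ρ` conjugated by the canonical isomorphisms `Γ(Spec R) ≅ R`. [folklore] -/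
private theorem appTop_specMap_eq (ρ : R ⟶ R₀) :
    (Spec.map ρ).appTop = (Scheme.ΓSpecIso R).hom ≫ ρ ≫ (Scheme.ΓSpecIso R₀).inv := by
  rw [← Category.assoc, ← Scheme.ΓSpecIso_naturality, Category.assoc, Iso.hom_inv_id,
    Category.comp_id]

/-- Surjectivity, kernel nilpotence and kernel finite generation pass from `ρ` to `Γ(Spec ρ)`.
[folklore] -/
private theorem appTop_specMap_surjective_ker (ρ : R ⟶ R₀) (hρ : Function.Surjective ρ.hom)
    (hnil : IsNilpotent (RingHom.ker ρ.hom)) (hfg : (RingHom.ker ρ.hom).FG) :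
    Function.Surjective (Spec.map ρ).appTop.hom ∧
      IsNilpotent (RingHom.ker (Spec.map ρ).appTop.hom) ∧
        (RingHom.ker (Spec.map ρ).appTop.hom).FG := by
  let e₁ : Γ(Spec R, ⊤) ≃+* R := (Scheme.ΓSpecIso R).commRingCatIsoToRingEquiv
  let e₂ : R₀ ≃+* Γ(Spec R₀, ⊤) := (Scheme.ΓSpecIso R₀).symm.commRingCatIsoToRingEquiv
  have heq : ∀ x, (Spec.map ρ).appTop.hom x = e₂ (ρ.hom (e₁ x)) := fun x =>
    congrArg (fun φ : Γ(Spec R, ⊤) ⟶ Γ(Spec R₀, ⊤) => φ.hom x) (appTop_specMap_eq ρ)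
  -- the kernel is the image of `ker ρ` under `e₁⁻¹`
  have hker : RingHom.ker (Spec.map ρ).appTop.hom = (RingHom.ker ρ.hom).map e₁.symm := by
    rw [Ideal.map_symm]
    ext x
    simp only [RingHom.mem_ker, Ideal.mem_comap, heq, map_eq_zero_iff _ e₂.injective]
  refine ⟨?_, ?_, ?_⟩
  · intro y
    obtain ⟨r, hr⟩ := hρ (e₂.symm y)
    exact ⟨e₁.symm r, by rw [heq, RingEquiv.apply_symm_apply, hr, RingEquiv.apply_symm_apply]⟩
  · rw [hker]
    obtain ⟨n, hn⟩ := hnil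
    exact ⟨n, by rw [← Ideal.map_pow, hn, Ideal.zero_eq_bot, Ideal.map_bot, Submodule.zero_eq_bot]⟩
  · rw [hker]
    exact hfg.map e₁.symm.toRingHom

/-- **Flatness modulo a nilpotent thickening of the base, `Spec` form.** Let `ρ : R ⟶ R₀` be a
surjective ring map with finitely generated nilpotent kernel, `q : Q ⟶ Spec R`, `f : P ⟶ Q`,
`hQ : IsPullback iQ q₀ q (Spec.map ρ)` (`Q₀ = Q ⊗_R R₀`), `hP : IsPullback iP f₀ f iQ`
(`P₀ = P ×_Q Q₀ = P ⊗_R R₀`). If `P` is flat over `R` and `f₀ = f ⊗_R R₀` is flat, then `f` is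
flat. [cite: Matsumura1987, §22 Thm. 22.3 (α), (3) ⇒ (1)] -/
theorem flat_of_flat_of_isPullback_specMap (ρ : R ⟶ R₀) (hρ : Function.Surjective ρ.hom)
    (hnil : IsNilpotent (RingHom.ker ρ.hom)) (hfg : (RingHom.ker ρ.hom).FG)
    (hQ : IsPullback iQ q₀ q (Spec.map ρ)) (hP : IsPullback iP f₀ f iQ) [Flat (f ≫ q)]
    [Flat f₀] : Flat f := by
  obtain ⟨h₁, h₂, h₃⟩ := appTop_specMap_surjective_ker ρ hρ hnil hfg
  exact flat_of_flat_of_isPullback_of_surjective_appTop h₁ h₂ h₃ hQ hP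

/-- **Flatness modulo a finitely generated nilpotent ideal of the base ring.** With
`Spec (R ⧸ J) ⟶ Spec R` for `J` nilpotent and finitely generated: if `P` is flat over `R` and
`f ⊗_R (R/J)` is flat then `f` is flat. [cite: Matsumura1987, §22 Thm. 22.3 (α), (3) ⇒ (1)] -/
theorem flat_of_flat_of_isPullback_specMap_quotient_mk {R : Type u} [CommRing R] (J : Ideal R)
    (hnil : IsNilpotent J) (hfg : J.FG) {q : Q ⟶ Spec (.of R)}
    {q₀ : Q₀ ⟶ Spec (.of (R ⧸ J))}
    (hQ : IsPullback iQ q₀ q (Spec.map (CommRingCat.ofHom (Ideal.Quotient.mk J))))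
    (hP : IsPullback iP f₀ f iQ) [Flat (f ≫ q)] [Flat f₀] : Flat f := by
  have hker : RingHom.ker (CommRingCat.ofHom (Ideal.Quotient.mk J)).hom = J := by
    rw [CommRingCat.hom_ofHom, Ideal.mk_ker]
  refine flat_of_flat_of_isPullback_specMap (CommRingCat.ofHom (Ideal.Quotient.mk J))
    Ideal.Quotient.mk_surjective ?_ ?_ hQ hP
  · rw [hker]; exact hnil
  · rw [hker]; exact hfg

/-- **Over an Artinian local base, flatness is detected on the closed fibre.** Let `R` be an
Artinian local ring with residue field `k`, `q : Q ⟶ Spec R`, `f : P ⟶ Q` with `P` flat over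
`R`; if the closed fibre `f ⊗_R k` is flat then `f` is flat (the maximal ideal of an Artinian
local ring is nilpotent and finitely generated). [cite: Matsumura1987, §22 Thm. 22.3 (α),
(3) ⇒ (1)] -/
theorem flat_of_flat_of_isPullback_specMap_residue {R : Type u} [CommRing R] [IsLocalRing R]
    [IsArtinianRing R] {q : Q ⟶ Spec (.of R)}
    {q₀ : Q₀ ⟶ Spec (.of (IsLocalRing.ResidueField R))}
    (hQ : IsPullback iQ q₀ q (Spec.map (CommRingCat.ofHom (IsLocalRing.residue R))))
    (hP : IsPullback iP f₀ f iQ) [Flat (f ≫ q)] [Flat f₀] : Flat f := by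
  have hker : RingHom.ker (CommRingCat.ofHom (IsLocalRing.residue R)).hom =
      IsLocalRing.maximalIdeal R := by
    rw [CommRingCat.hom_ofHom, IsLocalRing.ker_residue]
  refine flat_of_flat_of_isPullback_specMap (CommRingCat.ofHom (IsLocalRing.residue R))
    IsLocalRing.residue_surjective ?_ ?_ hQ hP
  · rw [hker, ← IsLocalRing.jacobson_eq_maximalIdeal (⊥ : Ideal R) bot_ne_top]
    exact IsArtinianRing.isNilpotent_jacobson_bot
  · rw [hker]; exact IsNoetherian.noetherian _

/-- **First-order deformations: flatness over `k[ε]` is detected modulo `ε`.** Let `k` be a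
commutative ring, `q : Q ⟶ Spec k[ε]`, `f : P ⟶ Q` with `P` flat over `k[ε]`; if `f ⊗_{k[ε]} k`
(base change along `TrivSqZeroExt.fst : k[ε] → k`, kernel `(ε)` of square zero) is flat then `f`
is flat. [cite: Matsumura1987, §22 Thm. 22.3 (α), (3) ⇒ (1)] -/
theorem flat_of_flat_of_isPullback_specMap_dualNumber_fst {k : Type u} [CommRing k]
    {q : Q ⟶ Spec (.of (DualNumber k))} {q₀ : Q₀ ⟶ Spec (.of k)}
    (hQ : IsPullback iQ q₀ q
      (Spec.map (CommRingCat.ofHom (TrivSqZeroExt.fstHom k k k).toRingHom)))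
    (hP : IsPullback iP f₀ f iQ) [Flat (f ≫ q)] [Flat f₀] : Flat f := by
  have hker : RingHom.ker (CommRingCat.ofHom (TrivSqZeroExt.fstHom k k k).toRingHom).hom =
      TrivSqZeroExt.kerIdeal k k := by
    rw [CommRingCat.hom_ofHom]; rfl
  refine flat_of_flat_of_isPullback_specMap
    (CommRingCat.ofHom (TrivSqZeroExt.fstHom k k k).toRingHom)
    (fun x => ⟨TrivSqZeroExt.inl x, TrivSqZeroExt.fst_inl k x⟩) ?_ ?_ hQ hP
  · rw [hker]
    exact ⟨2, by rw [TrivSqZeroExt.kerIdeal_sq, Submodule.zero_eq_bot]⟩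
  · rw [hker]
    refine ⟨{TrivSqZeroExt.inr 1}, le_antisymm ?_ ?_⟩
    · rw [Finset.coe_singleton, Ideal.span_le, Set.singleton_subset_iff, SetLike.mem_coe,
        TrivSqZeroExt.mem_kerIdeal_iff_inr, TrivSqZeroExt.snd_inr]
    · intro x hx
      rw [TrivSqZeroExt.mem_kerIdeal_iff_inr] at hx
      rw [hx, Finset.coe_singleton]
      have hx' : (TrivSqZeroExt.inr x.snd : DualNumber k) =
          TrivSqZeroExt.inl x.snd * TrivSqZeroExt.inr 1 := by
        rw [TrivSqZeroExt.inl_mul_inr, smul_eq_mul, mul_one]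
      rw [hx']
      exact Ideal.mul_mem_left _ _ (Ideal.subset_span rfl)

end SpecBase

end Literature.AlgebraicGeometry.Morphisms
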